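import Literature.MathematicalPhysics.QuantumLattice.GrassmannIntegrationByParts
import Literature.MathematicalPhysics.QuantumLattice.GrassmannIntegralSubstitution
import Literature.MathematicalPhysics.QuantumLattice.GrassmannParity
import HarnessLib

/-!
# Wick functionals are unique; a quadratic insertion renormalises the Gaussian covariance

Topic `Literature/MathematicalPhysics/QuantumLattice`; generic layer over `GrassmannLaplacian.lean` /
`GrassmannEffectiveAction.lean` / `GrassmannIntegrationByParts.lean` (the `e^{Δ_C}` calculus of Salmhofer 1999, §4.3),
for the Laplacian-form Gaussian expectation `gaussExpect R C F = constPart (e^{Δ_C} F)` of an ARBITRARY covariance `C`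
(no invertibility, no antisymmetry; `Γ` finite, `R` a commutative `ℚ`-algebra).

* **Uniqueness of Wick functionals** (`eq_zero_of_wick`, `eq_smul_of_wick`, `eq_smul_gaussExpect_of_wick`,
  `gaussExpect_eq_of_pairing_eq`): an `R`-linear functional `Φ` on the Grassmann algebra obeying the integration-by-parts (Wick)
  rule `Φ(ψ(X) a) = Σ_Y A(X,Y) Φ(∂_Y a)` is `Φ(1)` times the Gaussian expectation of any covariance with pair function `A`
  (Feldman–Knörrer–Trubowitz 2002, §I.2: the Wick rule and `∫ 1 dμ = 1` characterise the Grassmann Gaussian integral).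
  The proof is basis-free (`CliffordAlgebra.left_induction`, carrying all iterated derivatives
  `prod_map_grassmannDeriv_…`).
* **Derivations on exponentials of even nilpotents** (`leibniz_pow_succ_of_mem_evenOdd_zero`,
  `leibniz_grassmannExp_of_mem_evenOdd_zero`, `grassmannDeriv_grassmannExp_of_mem_evenOdd_zero`: `∂_X e^{g} = e^{g} ∂_X g`).
* **The quadratic insertion** `q = Σ_{X,Y} N(X,Y) ψ(X)ψ(Y)` (passed as the hypothesis `hq`; even, central, nilpotent, no
  constant part: `quadratic_mem_evenOdd_zero_of_eq`, `commute_of_eq_quadratic`, `isNilpotent_of_eq_quadratic`,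
  `constPart_eq_zero_of_eq_quadratic`): `grassmannDeriv_of_eq_quadratic` (`∂_Z q = Σ_Y (N(Z,Y) − N(Y,Z)) ψ(Y)`),
  `grassmannDeriv_grassmannExp_of_eq_quadratic`, and the TWISTED Wick rule for `F ↦ ∫ dμ_C e^{q} F`
  (`gaussExpect_grassmannExp_mul_gen_mul`), whose resolvent form is the plain Wick rule of the renormalised pair function
  `A' = M A`, `M (1 − A S) = 1`, `S = N − Nᵀ` (`wick_grassmannExp_mul_of_resolvent`); `A'` is again antisymmetric
  (`transpose_resolvent_mul_pairing`, the push-through identity `M A = A Mᵀ`).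
* **Main theorem** (`gaussExpect_grassmannExp_mul`; `gaussExpect_grassmannExp_mul_canonical` with `C' = −M A`;
  `gaussExpect_grassmannExp_mul_of_transpose_eq_neg` with `C' = M C` for antisymmetric `C`, where `A = −C` and
  `M (1 + C S) = 1`, i.e. `C' = (1 + C S)⁻¹ C = (C⁻¹ + S)⁻¹` when `C` is invertible):
  `∫ dμ_C e^{q} F = (∫ dμ_C e^{q}) · ∫ dμ_{C'} F` for every `F` — a quadratic term in the action may be moved freely between
  "interaction" and "covariance": the renormalisation of the free measure of Benfatto–Giuliani–Mastropietro 2006, (2.21)–(2.24)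
  (there for the Berezin form `e^{ψ̄Aψ}` over a field, tree file `GrassmannGaussianMeasureChange.lean`), and the statement behind
  "the counterterm `K` is treated as an extra interaction vertex" versus "`E = e + K` in the propagator" (Feldman–Salmhofer–Trubowitz
  1996, §1) — here for the Laplacian form used by the Hubbard effective-action files (singular cutoff covariances, Nambu /
  anomalous entries: no `ψ̄/ψ` block structure and no invertibility of `C` is assumed).
* `effPartitionFn_sub_of_transpose_eq_neg`: `∫ dμ_C e^{−(V − q)} = (∫ dμ_C e^{q}) · ∫ dμ_{M C} e^{−V}` for `V` without constant part.

Not here: the value of the normalisation `∫ dμ_C e^{q}` itself (a Pfaffian: `(∫ dμ_C e^{q})² = det(1 − A S)`), and the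
convolution-level (`gaussConv`) form of the statement.

Everything is proved; no definition is introduced (the quadratic element and the pair function are written out / passed as
hypotheses `hq`, `hA`).

## Sources

M. Salmhofer, *Renormalization: An Introduction* (Springer 1999), §4.3.1–4.3.2, (4.86)–(4.91) [`Salmhofer1999`];
J. Feldman, H. Knörrer, E. Trubowitz, *Fermionic Functional Integrals and the Renormalization Group* (CRM Monograph Series 16,
AMS 2002), §I.2–I.3 (Wick rule, Gaussian integrals with quadratic weights) [`FeldmanKnorrerTrubowitz2002`]; G. Benfatto,
A. Giuliani, V. Mastropietro, Ann. Henri Poincaré 7 (2006) 809, (2.21)–(2.24) [`BenfattoGiulianiMastropietro2006`]; J. Feldman,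
M. Salmhofer, E. Trubowitz, J. Stat. Phys. 84 (1996) 1209, §1 [`FeldmanSalmhoferTrubowitz1996`]. [folklore]
-/

noncomputable section

namespace Literature.MathematicalPhysics.QuantumLattice

open GrassmannAlgebra

variable (R : Type*) [CommRing R] [Algebra ℚ R] {Γ : Type*} [Fintype Γ] [DecidableEq Γ]

/-! ### Iterated derivatives -/

omit [Fintype Γ] [Algebra ℚ R] [DecidableEq Γ] in
/-- Appending a derivative to an iterated derivative: `(∂_{l} ∘ ∂_Y) a = ∂_l (∂_Y a)`. [folklore] -/
theorem prod_map_grassmannDeriv_append_singleton (l : List Γ) (Y : Γ) (a : GrassmannAlgebra R Γ) :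
    ((l ++ [Y]).map (grassmannDeriv R)).prod a = (l.map (grassmannDeriv R)).prod (grassmannDeriv R Y a) := by
  rw [List.map_append, List.prod_append, List.map_singleton, List.prod_singleton, Module.End.mul_apply]

omit [Fintype Γ] [Algebra ℚ R] [DecidableEq Γ] in
/-- A nonempty iterated derivative kills scalars. [folklore] -/
theorem prod_map_grassmannDeriv_algebraMap_of_ne_nil {l : List Γ} (hl : l ≠ []) (r : R) :
    (l.map (grassmannDeriv R)).prod (algebraMap R (GrassmannAlgebra R Γ) r) = 0 := by
  rw [← List.dropLast_append_getLast hl, prod_map_grassmannDeriv_append_singleton, grassmannDeriv_algebraMap, map_zero]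

/-! ### Uniqueness of Wick functionals -/

omit [Algebra ℚ R] in
/-- **A Wick functional vanishing at `1` vanishes identically.**  If an `R`-linear functional `D` on the Grassmann
algebra obeys the integration-by-parts rule `D(ψ(X) a) = Σ_Y A(X,Y) D(∂_Y a)` for some matrix `A` and `D 1 = 0`, then
`D = 0` (induction over `CliffordAlgebra.left_induction`, carrying all iterated derivatives). [cite: FeldmanKnorrerTrubowitz2002, §I.2] -/
theorem eq_zero_of_wick (D : GrassmannAlgebra R Γ →ₗ[R] R) (A : Matrix Γ Γ R)
    (hD : ∀ (X : Γ) (a : GrassmannAlgebra R Γ), D (gen R X * a) = ∑ Y, A X Y * D (grassmannDeriv R Y a))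
    (h1 : D 1 = 0) : D = 0 := by
  -- `S a`: every iterated derivative of `a` is killed by `D`
  suffices hS : ∀ (a : GrassmannAlgebra R Γ) (l : List Γ), D ((l.map (grassmannDeriv R)).prod a) = 0 by
    refine LinearMap.ext fun a => ?_
    simpa using hS a []
  intro a
  induction a using CliffordAlgebra.left_induction with
  | algebraMap r =>
    intro l
    rcases eq_or_ne l [] with rfl | hl
    · rw [List.map_nil, List.prod_nil, Module.End.one_apply, Algebra.algebraMap_eq_smul_one, map_smul, h1, smul_zero]
    · rw [prod_map_grassmannDeriv_algebraMap_of_ne_nil R hl, map_zero]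
  | add x y hx hy => intro l; rw [map_add, map_add, hx, hy, add_zero]
  | ι_mul x v hx =>
    -- closure of `S` under derivatives, then induction on the list from the right
    have hx' : ∀ (l : List Γ) (b : GrassmannAlgebra R Γ),
        (∀ l' : List Γ, D ((l'.map (grassmannDeriv R)).prod b) = 0) →
        D ((l.map (grassmannDeriv R)).prod (ExteriorAlgebra.ι R v * b)) = 0 := by
      intro l
      induction l using List.reverseRecOn with
      | nil =>
        intro b hb
        rw [List.map_nil, List.prod_nil, Module.End.one_apply, ι_eq_sum_gen R v, Finset.sum_mul, map_sum]
        refine Finset.sum_eq_zero fun X _ => ?_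
        rw [smul_mul_assoc, map_smul, hD]
        refine smul_eq_zero_of_right _ (Finset.sum_eq_zero fun Y _ => ?_)
        have := hb [Y]
        rw [List.map_singleton, List.prod_singleton] at this
        rw [this, mul_zero]
      | append_singleton L Y ih =>
        intro b hb
        rw [prod_map_grassmannDeriv_append_singleton, grassmannDeriv_ι_mul, map_sub, map_sub, LinearMap.map_smul_of_tower,
          map_smul, hb L, smul_zero, zero_sub, neg_eq_zero]
        exact ih (grassmannDeriv R Y b) fun l' => by rw [← prod_map_grassmannDeriv_append_singleton]; exact hb _
    intro l
    exact hx' l x hx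

omit [Algebra ℚ R] in
/-- **Uniqueness of Wick functionals**: two `R`-linear functionals obeying the same Wick rule
`Φ(ψ(X) a) = Σ_Y A(X,Y) Φ(∂_Y a)`, the second normalised (`Ψ 1 = 1`), satisfy `Φ = Φ(1) · Ψ`. [cite: FeldmanKnorrerTrubowitz2002, §I.2] -/
theorem eq_smul_of_wick (Φ Ψ : GrassmannAlgebra R Γ →ₗ[R] R) (A : Matrix Γ Γ R)
    (hΦ : ∀ (X : Γ) (a : GrassmannAlgebra R Γ), Φ (gen R X * a) = ∑ Y, A X Y * Φ (grassmannDeriv R Y a))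
    (hΨ : ∀ (X : Γ) (a : GrassmannAlgebra R Γ), Ψ (gen R X * a) = ∑ Y, A X Y * Ψ (grassmannDeriv R Y a))
    (hΨ1 : Ψ 1 = 1) : Φ = Φ 1 • Ψ := by
  have hW : ∀ (X : Γ) (a : GrassmannAlgebra R Γ),
      (Φ - Φ 1 • Ψ) (gen R X * a) = ∑ Y, A X Y * (Φ - Φ 1 • Ψ) (grassmannDeriv R Y a) := by
    intro X a
    simp only [LinearMap.sub_apply, LinearMap.smul_apply, smul_eq_mul]
    rw [hΦ X a, hΨ X a, Finset.mul_sum, ← Finset.sum_sub_distrib]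
    refine Finset.sum_congr rfl fun Y _ => ?_
    ring
  have h := eq_zero_of_wick R (Φ - Φ 1 • Ψ) A hW (by simp [hΨ1])
  exact sub_eq_zero.1 h

/-- **The Wick rule characterises the Gaussian expectation**: a functional obeying the Wick rule with the pair function
`A(X,Y) = ½(C(Y,X) − C(X,Y)) = ∫ dμ_C ψ(X)ψ(Y)` of a covariance `C` is `Φ(1) · ∫ dμ_C` (Salmhofer 1999, (4.91);
Feldman–Knörrer–Trubowitz 2002, §I.2). [cite: Salmhofer1999, §4.3.2 (4.91)] -/
theorem eq_smul_gaussExpect_of_wick (Φ : GrassmannAlgebra R Γ →ₗ[R] R) (C : Matrix Γ Γ R)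
    (hΦ : ∀ (X : Γ) (a : GrassmannAlgebra R Γ),
      Φ (gen R X * a) = ∑ Y, (((1 / 2 : ℚ) • (1 : R)) * (C Y X - C X Y)) * Φ (grassmannDeriv R Y a)) :
    Φ = Φ 1 • gaussExpect R C :=
  eq_smul_of_wick R Φ (gaussExpect R C) (Matrix.of fun X Y => ((1 / 2 : ℚ) • (1 : R)) * (C Y X - C X Y))
    (fun X a => by simpa only [Matrix.of_apply] using hΦ X a)
    (fun X a => by simpa only [Matrix.of_apply] using gaussExpect_gen_mul R C X a) (gaussExpect_one R C)

/-- Two covariances with the same pair function have the same Gaussian expectation (only the antisymmetric part of `C`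
matters). [folklore] -/
theorem gaussExpect_eq_of_pairing_eq {C C' : Matrix Γ Γ R} (h : ∀ X Y, C Y X - C X Y = C' Y X - C' X Y) :
    gaussExpect R C = gaussExpect R C' := by
  have := eq_smul_gaussExpect_of_wick R (gaussExpect R C) C' (fun X a => by
    rw [gaussExpect_gen_mul]
    simp only [h])
  rwa [gaussExpect_one, one_smul] at this

/-! ### Derivations on exponentials of even nilpotents -/

omit [Algebra ℚ R] [Fintype Γ] [DecidableEq Γ] in
/-- **Power rule for an even base**: a linear operator `D` obeying the Leibniz rule on left multiples of an even (hence
central) element `c` differentiates its powers classically, `D (c^(n+1)) = (n+1) · c^n · D c`. [folklore] -/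
theorem leibniz_pow_succ_of_mem_evenOdd_zero (D : GrassmannAlgebra R Γ →ₗ[R] GrassmannAlgebra R Γ)
    {c : GrassmannAlgebra R Γ} (hc : c ∈ evenOdd R 0) (hD : ∀ b, D (c * b) = D c * b + c * D b) (n : ℕ) :
    D (c ^ (n + 1)) = ((n + 1 : ℕ) : R) • (c ^ n * D c) := by
  induction n with
  | zero => rw [zero_add, pow_one, pow_zero, one_mul, Nat.cast_one, one_smul]
  | succ n ih =>
    rw [pow_succ' c (n + 1), hD, ih, ← (commute_of_mem_evenOdd_zero R (pow_mem_evenOdd_zero R hc (n + 1)) (D c)).eq,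
      mul_smul_comm, ← mul_assoc, ← pow_succ', Nat.cast_succ (n + 1), add_smul, one_smul, add_comm]

omit [Fintype Γ] [DecidableEq Γ] in
/-- **Chain rule for the exponential of an even nilpotent**: a linear operator `D` with `D 1 = 0` obeying the Leibniz rule
on left multiples of an even nilpotent `c` satisfies `D e^{c} = e^{c} · D c`. [folklore] -/
theorem leibniz_grassmannExp_of_mem_evenOdd_zero (D : GrassmannAlgebra R Γ →ₗ[R] GrassmannAlgebra R Γ) (hD1 : D 1 = 0)
    {c : GrassmannAlgebra R Γ} (hc : c ∈ evenOdd R 0) (hn : IsNilpotent c) (hD : ∀ b, D (c * b) = D c * b + c * D b) :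
    D (grassmannExp c) = grassmannExp c * D c := by
  obtain ⟨k, hk⟩ := hn
  have hk1 : c ^ (k + 1) = 0 := by rw [pow_succ, hk, zero_mul]
  have hL : grassmannExp c = ∑ i ∈ Finset.range (k + 1), ((i.factorial : ℚ)⁻¹) • c ^ i :=
    IsNilpotent.exp_eq_sum hk1
  have hR : grassmannExp c = ∑ i ∈ Finset.range k, ((i.factorial : ℚ)⁻¹) • c ^ i :=
    IsNilpotent.exp_eq_sum hk
  conv_lhs => rw [hL, map_sum, Finset.sum_range_succ']
  conv_rhs => rw [hR, Finset.sum_mul]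
  simp only [LinearMap.map_smul_of_tower, pow_zero, hD1, smul_zero, add_zero,
    leibniz_pow_succ_of_mem_evenOdd_zero R D hc hD, inv_factorial_succ_smul_succ_smul, smul_mul_assoc]

omit [Fintype Γ] [DecidableEq Γ] in
/-- **The left derivative of the exponential of an even nilpotent**: `∂_X e^{g} = e^{g} · ∂_X g` (the graded Leibniz rule is
the plain one on the even factor `g`, which is central). [folklore] -/
theorem grassmannDeriv_grassmannExp_of_mem_evenOdd_zero (X : Γ) {g : GrassmannAlgebra R Γ} (hg : g ∈ evenOdd R 0)
    (hn : IsNilpotent g) : grassmannDeriv R X (grassmannExp g) = grassmannExp g * grassmannDeriv R X g :=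
  leibniz_grassmannExp_of_mem_evenOdd_zero R (grassmannDeriv R X) (grassmannDeriv_one R X) hg hn
    fun b => grassmannDeriv_mul_of_involute_eq R X (CliffordAlgebra.involute_eq_of_mem_even hg) b

/-- The exponential of an even nilpotent is even: this is `grassmannExp_mem_evenOdd_zero` of
`GrassmannParity`; the primed name is kept as a deprecated alias only. [folklore] -/
@[deprecated grassmannExp_mem_evenOdd_zero (since := "2026-08-17")]
alias grassmannExp_mem_evenOdd_zero' := grassmannExp_mem_evenOdd_zero

/-! ### The quadratic insertion `q = Σ_{X,Y} N(X,Y) ψ(X)ψ(Y)` -/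

section Quadratic

variable {R}
variable (N : Matrix Γ Γ R) {q : GrassmannAlgebra R Γ} (hq : q = ∑ X, ∑ Y, N X Y • (gen R X * gen R Y))
include hq

omit [Algebra ℚ R] in
/-- A quadratic element is even. [folklore] -/
theorem quadratic_mem_evenOdd_zero_of_eq : q ∈ evenOdd R 0 := by
  subst hq
  refine Submodule.sum_mem _ fun X _ => Submodule.sum_mem _ fun Y _ => Submodule.smul_mem _ _ ?_
  exact CliffordAlgebra.ι_mul_ι_mem_evenOdd_zero _ _ _

omit [Algebra ℚ R] in
/-- A quadratic element has no constant part. [folklore] -/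
theorem constPart_eq_zero_of_eq_quadratic : constPart R q = 0 := by
  subst hq
  simp [map_sum]

omit [Algebra ℚ R] in
/-- A quadratic element is nilpotent. [folklore] -/
theorem isNilpotent_of_eq_quadratic : IsNilpotent q :=
  isNilpotent_of_constPart_eq_zero R (constPart_eq_zero_of_eq_quadratic N hq)

omit [Algebra ℚ R] in
/-- A quadratic element is central. [folklore] -/
theorem commute_of_eq_quadratic (z : GrassmannAlgebra R Γ) : Commute q z :=
  commute_of_mem_evenOdd_zero R (quadratic_mem_evenOdd_zero_of_eq N hq) z

omit [Algebra ℚ R] in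
/-- **The derivative of the quadratic element**: `∂_Z Σ N(X,Y)ψ(X)ψ(Y) = Σ_Y (N(Z,Y) − N(Y,Z)) ψ(Y)` — only `S = N − Nᵀ`
enters. [folklore] -/
theorem grassmannDeriv_of_eq_quadratic (Z : Γ) : grassmannDeriv R Z q = ∑ Y, (N Z Y - N Y Z) • gen R Y := by
  subst hq
  have h1 : ∀ X : Γ, (∑ Y, if Z = X then N X Y • gen R Y else 0) = if Z = X then ∑ Y, N X Y • gen R Y else 0 := by
    intro X
    split_ifs <;> simp
  simp only [map_sum, map_smul, grassmannDeriv_gen_mul_gen, smul_sub, Finset.sum_sub_distrib, smul_ite, smul_zero,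
    Finset.sum_ite_eq, Finset.mem_univ, if_true, sub_smul]
  rw [Finset.sum_congr rfl fun X _ => h1 X, Finset.sum_ite_eq]
  simp

/-- `∂_Z e^{q} = e^{q} · Σ_Y (N(Z,Y) − N(Y,Z)) ψ(Y)`. [folklore] -/
theorem grassmannDeriv_grassmannExp_of_eq_quadratic (Z : Γ) :
    grassmannDeriv R Z (grassmannExp q) = grassmannExp q * ∑ Y, (N Z Y - N Y Z) • gen R Y := by
  rw [grassmannDeriv_grassmannExp_of_mem_evenOdd_zero R Z (quadratic_mem_evenOdd_zero_of_eq N hq)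
    (isNilpotent_of_eq_quadratic N hq), grassmannDeriv_of_eq_quadratic N hq]

/-- `e^{q}` is central. [folklore] -/
theorem commute_grassmannExp_of_eq_quadratic (z : GrassmannAlgebra R Γ) : Commute (grassmannExp q) z :=
  commute_of_mem_evenOdd_zero R
    (grassmannExp_mem_evenOdd_zero R (quadratic_mem_evenOdd_zero_of_eq N hq) (isNilpotent_of_eq_quadratic N hq)) z

/-- **The twisted Wick rule**: for the functional `F ↦ ∫ dμ_C e^{q} F`,
`∫ dμ_C e^{q} ψ(X) F = Σ_Y A(X,Y) (∫ dμ_C e^{q} ∂_Y F + Σ_Z (N(Y,Z) − N(Z,Y)) ∫ dμ_C e^{q} ψ(Z) F)`,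
`A(X,Y) = ½(C(Y,X) − C(X,Y))` (Wick's rule past the even weight `e^{q}`, whose derivative re-inserts a field).
[cite: Salmhofer1999, §4.3.2 (4.91)] -/
theorem gaussExpect_grassmannExp_mul_gen_mul (C : Matrix Γ Γ R) (X : Γ) (F : GrassmannAlgebra R Γ) :
    gaussExpect R C (grassmannExp q * (gen R X * F)) =
      ∑ Y, (((1 / 2 : ℚ) • (1 : R)) * (C Y X - C X Y)) *
        (gaussExpect R C (grassmannExp q * grassmannDeriv R Y F) +
          ∑ Z, (N Y Z - N Z Y) * gaussExpect R C (grassmannExp q * (gen R Z * F))) := by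
  have hE := grassmannExp_mem_evenOdd_zero R (quadratic_mem_evenOdd_zero_of_eq N hq) (isNilpotent_of_eq_quadratic N hq)
  rw [← mul_assoc, (commute_grassmannExp_of_eq_quadratic N hq (gen R X)).eq, mul_assoc, gaussExpect_gen_mul]
  refine Finset.sum_congr rfl fun Y _ => ?_
  congr 1
  rw [grassmannDeriv_mul_of_involute_eq R Y (CliffordAlgebra.involute_eq_of_mem_even hE), map_add, add_comm,
    grassmannDeriv_grassmannExp_of_eq_quadratic N hq, mul_assoc, Finset.sum_mul, Finset.mul_sum, map_sum]
  congr 1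
  refine Finset.sum_congr rfl fun Z _ => ?_
  rw [smul_mul_assoc, mul_smul_comm, map_smul, smul_eq_mul]

end Quadratic

/-! ### The resolvent: the renormalised pair function `A' = (1 − A S)⁻¹ A`, `S = N − Nᵀ` -/

omit [Algebra ℚ R] [DecidableEq Γ] in
/-- `½·(x + x) = x` in a `ℚ`-algebra. [folklore] -/
theorem half_smul_one_mul_add_self [Algebra ℚ R] (x : R) : ((1 / 2 : ℚ) • (1 : R)) * (x + x) = x := by
  rw [smul_mul_assoc, one_mul, ← two_smul ℚ x, smul_smul]
  norm_num

omit [Algebra ℚ R] in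
/-- **The renormalised pair function is antisymmetric**: if `Aᵀ = −A`, `Sᵀ = −S` and `M (1 − A S) = 1`, then
`(M A)ᵀ = −M A` (indeed `M A = A Mᵀ`, `Mᵀ = (1 − S A)⁻¹`: the push-through identity). [folklore] -/
theorem transpose_resolvent_mul_pairing {A S M : Matrix Γ Γ R} (hAt : A.transpose = -A) (hSt : S.transpose = -S)
    (hM : M * (1 - A * S) = 1) : (M * A).transpose = -(M * A) := by
  -- `Mᵀ` is the inverse of `1 - S A`
  have hT : (1 - S * A) * M.transpose = 1 := by
    have h := congrArg Matrix.transpose hM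
    rwa [Matrix.transpose_mul, Matrix.transpose_sub, Matrix.transpose_one, Matrix.transpose_mul, hAt, hSt,
      neg_mul_neg] at h
  -- push-through: `M A = A Mᵀ`
  have key : M * A = A * M.transpose := by
    calc M * A = M * A * ((1 - S * A) * M.transpose) := by rw [hT, Matrix.mul_one]
      _ = M * (1 - A * S) * A * M.transpose := by
          simp only [Matrix.mul_sub, Matrix.sub_mul, Matrix.mul_one, Matrix.one_mul, Matrix.mul_assoc]
      _ = A * M.transpose := by rw [hM, Matrix.one_mul]
  rw [key, Matrix.transpose_mul, Matrix.transpose_transpose, hAt, Matrix.mul_neg, key]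

omit [Fintype Γ] [DecidableEq Γ] in
/-- The pair function `A(X,Y) = ½(C(Y,X) − C(X,Y))` of any covariance is antisymmetric. [folklore] -/
theorem transpose_pairing_eq_neg (C : Matrix Γ Γ R) :
    (Matrix.of fun X Y => ((1 / 2 : ℚ) • (1 : R)) * (C Y X - C X Y)).transpose =
      -Matrix.of fun X Y => ((1 / 2 : ℚ) • (1 : R)) * (C Y X - C X Y) := by
  ext X Y
  simp only [Matrix.transpose_apply, Matrix.of_apply, Matrix.neg_apply, ← mul_neg, neg_sub]

omit [Algebra ℚ R] [Fintype Γ] [DecidableEq Γ] in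
/-- `S = N − Nᵀ` is antisymmetric. [folklore] -/
theorem transpose_sub_transpose_eq_neg (N : Matrix Γ Γ R) :
    (Matrix.of fun X Y => N X Y - N Y X).transpose = -Matrix.of fun X Y => N X Y - N Y X := by
  ext X Y
  simp only [Matrix.transpose_apply, Matrix.of_apply, Matrix.neg_apply, neg_sub]

section Resolvent

variable {R}
variable (N : Matrix Γ Γ R) {q : GrassmannAlgebra R Γ} (hq : q = ∑ X, ∑ Y, N X Y • (gen R X * gen R Y))
variable (C : Matrix Γ Γ R) {A S M : Matrix Γ Γ R}
  (hA : A = Matrix.of fun X Y => ((1 / 2 : ℚ) • (1 : R)) * (C Y X - C X Y))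
  (hS : S = Matrix.of fun X Y => N X Y - N Y X) (hM : M * (1 - A * S) = 1)
include hq hA hS hM

/-- **The resolvent form of the twisted Wick rule**: if `M (1 − A S) = 1` (`A` the pair function of `C`, `S = N − Nᵀ`), the
functional `F ↦ ∫ dμ_C e^{q} F` obeys the plain Wick rule with the RENORMALISED pair function `A' = M A = (1 − A S)⁻¹ A`:
`∫ dμ_C e^{q} ψ(X) F = Σ_Y A'(X,Y) ∫ dμ_C e^{q} ∂_Y F`. [cite: FeldmanKnorrerTrubowitz2002, §I.3] -/
theorem wick_grassmannExp_mul_of_resolvent (X : Γ) (F : GrassmannAlgebra R Γ) :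
    gaussExpect R C (grassmannExp q * (gen R X * F)) =
      ∑ Y, (M * A) X Y * gaussExpect R C (grassmannExp q * grassmannDeriv R Y F) := by
  -- the vectors `φ(Z) = ∫ e^{q} ψ(Z) F` and `d(Y) = ∫ e^{q} ∂_Y F`
  set φ : Γ → R := fun Z => gaussExpect R C (grassmannExp q * (gen R Z * F)) with hφ
  set d : Γ → R := fun Y => gaussExpect R C (grassmannExp q * grassmannDeriv R Y F) with hd
  -- the twisted Wick rule in vector form: `φ = A d + (A S) φ`
  have hvec : φ = A.mulVec d + (A * S).mulVec φ := by
    funext Z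
    rw [Pi.add_apply, ← Matrix.mulVec_mulVec]
    simp only [hφ, hd, Matrix.mulVec, dotProduct, hA, hS, Matrix.of_apply, ← Finset.sum_add_distrib, ← mul_add]
    exact gaussExpect_grassmannExp_mul_gen_mul N hq C Z F
  have hsolve : φ = (M * A).mulVec d := by
    have h1 : (1 - A * S).mulVec φ = A.mulVec d := by
      rw [Matrix.sub_mulVec, Matrix.one_mulVec, sub_eq_iff_eq_add]
      exact hvec
    calc φ = (M * (1 - A * S)).mulVec φ := by rw [hM, Matrix.one_mulVec]
      _ = (M * A).mulVec d := by rw [← Matrix.mulVec_mulVec, h1, Matrix.mulVec_mulVec]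
  have := congrFun hsolve X
  simpa only [hφ, hd, Matrix.mulVec, dotProduct] using this

/-- **A quadratic insertion renormalises the covariance** (general form).  With `A(X,Y) = ½(C(Y,X) − C(X,Y))` the pair
function of `C`, `S = N − Nᵀ`, `M (1 − A S) = 1`, and `C'` ANY covariance whose pair function is `M A`:
`∫ dμ_C e^{q} F = (∫ dμ_C e^{q}) · ∫ dμ_{C'} F` for every `F` — the Laplacian-form counterpart of the renormalisation of the free
measure `⟨e^{ψ̄Nψ} X⟩_A = (det(A+N)/det A) ⟨X⟩_{A+N}` (Benfatto–Giuliani–Mastropietro 2006, (2.23)–(2.24);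
Feldman–Knörrer–Trubowitz 2002, §I.3). [cite: BenfattoGiulianiMastropietro2006, (2.23)–(2.24)] -/
theorem gaussExpect_grassmannExp_mul {C' : Matrix Γ Γ R}
    (hC' : ∀ X Y, ((1 / 2 : ℚ) • (1 : R)) * (C' Y X - C' X Y) = (M * A) X Y) (F : GrassmannAlgebra R Γ) :
    gaussExpect R C (grassmannExp q * F) = gaussExpect R C (grassmannExp q) * gaussExpect R C' F := by
  set Φ : GrassmannAlgebra R Γ →ₗ[R] R := gaussExpect R C ∘ₗ LinearMap.mulLeft R (grassmannExp q) with hΦdef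
  have hΦ : ∀ (X : Γ) (a : GrassmannAlgebra R Γ),
      Φ (gen R X * a) = ∑ Y, (((1 / 2 : ℚ) • (1 : R)) * (C' Y X - C' X Y)) * Φ (grassmannDeriv R Y a) := by
    intro X a
    simp only [hΦdef, LinearMap.coe_comp, Function.comp_apply, LinearMap.mulLeft_apply, hC']
    exact wick_grassmannExp_mul_of_resolvent N hq C hA hS hM X a
  have h := eq_smul_gaussExpect_of_wick R Φ C' hΦ
  have hF := LinearMap.congr_fun h F
  simp only [hΦdef, LinearMap.coe_comp, Function.comp_apply, LinearMap.mulLeft_apply, LinearMap.smul_apply,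
    smul_eq_mul, mul_one] at hF
  exact hF

/-- **A quadratic insertion renormalises the covariance** (canonical form): with the hypotheses of
`gaussExpect_grassmannExp_mul`, `∫ dμ_C e^{q} F = (∫ dμ_C e^{q}) · ∫ dμ_{−MA} F` (the renormalised pair function `M A` is
antisymmetric, so `−M A` is a covariance realising it). [cite: BenfattoGiulianiMastropietro2006, (2.23)–(2.24)] -/
theorem gaussExpect_grassmannExp_mul_canonical (F : GrassmannAlgebra R Γ) :
    gaussExpect R C (grassmannExp q * F) = gaussExpect R C (grassmannExp q) * gaussExpect R (-(M * A)) F := by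
  have hanti : (M * A).transpose = -(M * A) :=
    transpose_resolvent_mul_pairing R (hA ▸ transpose_pairing_eq_neg R C) (hS ▸ transpose_sub_transpose_eq_neg R N) hM
  refine gaussExpect_grassmannExp_mul N hq C hA hS hM (fun X Y => ?_) F
  have hYX : (M * A) Y X = -(M * A) X Y := by
    rw [← Matrix.transpose_apply (M * A) X Y, hanti, Matrix.neg_apply]
  rw [Matrix.neg_apply, Matrix.neg_apply, hYX, neg_neg, sub_neg_eq_add, half_smul_one_mul_add_self]

end Resolvent

/-! ### Antisymmetric covariances: `C' = (1 + C S)⁻¹ C` -/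

omit [Fintype Γ] [DecidableEq Γ] in
/-- For an antisymmetric covariance the pair function is `A = −C`. [folklore] -/
theorem pairing_eq_neg_of_transpose_eq_neg {C : Matrix Γ Γ R} (hC : C.transpose = -C) :
    (Matrix.of fun X Y => ((1 / 2 : ℚ) • (1 : R)) * (C Y X - C X Y)) = -C := by
  ext X Y
  have hYX : C Y X = -C X Y := by rw [← Matrix.transpose_apply C X Y, hC, Matrix.neg_apply]
  rw [Matrix.of_apply, Matrix.neg_apply, hYX, ← neg_add', mul_neg, half_smul_one_mul_add_self]

section Antisymmetric

variable {R}
variable (N : Matrix Γ Γ R) {q : GrassmannAlgebra R Γ} (hq : q = ∑ X, ∑ Y, N X Y • (gen R X * gen R Y))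
variable {C S M : Matrix Γ Γ R} (hC : C.transpose = -C) (hS : S = Matrix.of fun X Y => N X Y - N Y X)
  (hM : M * (1 + C * S) = 1)
include hq hC hS hM

/-- **A quadratic insertion renormalises an antisymmetric covariance**: for `Cᵀ = −C`, `S = N − Nᵀ` and `M (1 + C S) = 1`,
`∫ dμ_C e^{Σ N(X,Y)ψ(X)ψ(Y)} F = (∫ dμ_C e^{Σ N ψψ}) · ∫ dμ_{M C} F` — the new covariance is `(1 + C S)⁻¹ C`
(`= (C⁻¹ + S)⁻¹` when `C` is invertible: a quadratic term moves freely between action and covariance; Feldman–Salmhofer–Trubowitz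
1996, §1, "`E = e + K`" versus the counterterm as an interaction vertex). [cite: BenfattoGiulianiMastropietro2006, (2.23)–(2.24)] -/
theorem gaussExpect_grassmannExp_mul_of_transpose_eq_neg (F : GrassmannAlgebra R Γ) :
    gaussExpect R C (grassmannExp q * F) = gaussExpect R C (grassmannExp q) * gaussExpect R (M * C) F := by
  have hA := pairing_eq_neg_of_transpose_eq_neg R hC
  have hM' : M * (1 - (-C) * S) = 1 := by rwa [neg_mul, sub_neg_eq_add]
  have h := gaussExpect_grassmannExp_mul_canonical N hq C hA.symm hS hM' F
  rwa [Matrix.mul_neg, neg_neg] at h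

/-- **The counterterm moves between interaction and covariance**: for an interaction `V` without constant part,
`∫ dμ_C e^{−(V − q)} = (∫ dμ_C e^{q}) · ∫ dμ_{M C} e^{−V}`, i.e. `effPartitionFn C (V − q) = (∫ dμ_C e^{q}) · effPartitionFn (M C) V`
(`Cᵀ = −C`, `S = N − Nᵀ`, `M (1 + C S) = 1`). [cite: FeldmanSalmhoferTrubowitz1996, §1] -/
theorem effPartitionFn_sub_of_transpose_eq_neg {V : GrassmannAlgebra R Γ} (hV : constPart R V = 0) :
    effPartitionFn R C (V - q) = gaussExpect R C (grassmannExp q) * effPartitionFn R (M * C) V := by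
  have hqn : IsNilpotent q := isNilpotent_of_eq_quadratic N hq
  have hVn : IsNilpotent (-V) := isNilpotent_of_constPart_eq_zero R (by rw [map_neg, hV, neg_zero])
  rw [effPartitionFn_eq_gaussExpect, effPartitionFn_eq_gaussExpect, neg_sub, sub_eq_add_neg, grassmannExp,
    IsNilpotent.exp_add_of_commute (commute_of_eq_quadratic N hq (-V)) hqn hVn]
  exact gaussExpect_grassmannExp_mul_of_transpose_eq_neg N hq hC hS hM _

end Antisymmetric

end Literature.MathematicalPhysics.QuantumLattice
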